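import Summits.Schanuel.Schanuel.Theses.RootDecomp1

/-!
# RootDecomp1 — ROUND 6 glue «EntanglementLayer» (lens 1, gen 6): `Cᵉ → D → Cⁿᵘ`

Proves the D-0019 glue item `NonrationalSaturatedEssentialSchanuelGlue` (stmt-Schanuel-30354) of the split of the round-5 residual
Cⁿᵘ = `NonrationalSaturatedEssentialSchanuel` (stmt-Schanuel-29645) by the ENTANGLEMENT GRADE
ε = trdeg ℚ(z) + trdeg ℚ(e^z) − trdeg ℚ(z, e^z) into D = `DisjointSaturatedEssentialSchanuel` (stmt-Schanuel-30353, ε = 0) and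
Cᵉ = `EntangledSaturatedEssentialSchanuel` (stmt-Schanuel-30352, ε ≥ 1, the new declared residual): at a tight atom of the residual
either `trdeg ℚ(z) + trdeg ℚ(e^z) ≤ trdeg ℚ(z, e^z)` (apply D) or not (apply Cᵉ).  Port of `nonrational_of_disjoint_entangled` of
`HOME/decomp-schanuel-lens-1/g6/EntanglementLayer.lean` (critic CLEARED FOR TYPING 07:33:31Z; typed revs 15–20, 07:52:18Z) by the census
seat (prover role), over the route decls (binder order of the gate's glue: Cᵉ first); this file defines nothing; no transcendence input.
-/

set_option linter.dupNamespace false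

noncomputable section

namespace Summit.Schanuel.Schanuel.Theorems.RootDecomp1EntanglementSplit

open Summit.Schanuel.Schanuel.Theses.RootDecomp1

/-- Item stmt-Schanuel-30354 (glue of the split of `NonrationalSaturatedEssentialSchanuel`): excluded middle on the entanglement
inequality `trdeg ℚ(z) + trdeg ℚ(e^z) ≤ trdeg ℚ(z, e^z)`. -/
theorem nonrationalSaturatedEssentialSchanuelGlue_holds : NonrationalSaturatedEssentialSchanuelGlue := by
  intro hE hDj n hn z hz hecl hgen hsat hlin hquad hrat
  by_cases h : Algebra.trdeg ℚ ↥(IntermediateField.adjoin ℚ (Set.range z)) +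
      Algebra.trdeg ℚ ↥(IntermediateField.adjoin ℚ (Set.range (Complex.exp ∘ z))) ≤
      Algebra.trdeg ℚ ↥(IntermediateField.adjoin ℚ (Set.range z ∪ Set.range (Complex.exp ∘ z)))
  · exact hDj n hn z hz hecl hgen hsat hlin hquad hrat h
  · exact hE n hn z hz hecl hgen hsat hlin hquad hrat (not_le.mp h)

end Summit.Schanuel.Schanuel.Theorems.RootDecomp1EntanglementSplit
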